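import Summits.QuantumFields.BalabanUV.T4Continuum.Support.NE7LawLevelStability

/-!
# NE7, ROAD P4 (law-level), item (k7): the stability of conditional dressing means under a tilt that is sandwiched
# only OFF A BAD SET of paths — bad classes ∕ core complements of the window's levels enter as MEAN defects

(Cell `pub-balaban`, sub-cell `t4`, binder row NE7 = node U5, co-owner #4 `b2b-balaban-t4-ne7-p4`; skeleton
`HOME/t4/skeletons/NE7-t4-ne7-p4.md` §2 NODE Q, item (k7).  Sibling of `NE7LawLevelStability` (p207751), which it imports.)

HONEST FRAMING (T4-DAG PAGE 1).  Rung (B)+1 on ONE FIXED finite four-torus, CONDITIONAL on `BetaPertH` and the nine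
spine estimates (0/9 proved); NOT infinite volume, NOT a mass gap, NOT the Clay problem.  NE7 is NOT PRINTED and NOT
proved here.  Pure [folklore] measure theory, sorry-free; no statement of the audited series is asserted; NOT summit
progress.

THE POINT.  `NE7LawLevelStability.integral_abs_dressing_sub_le_of_sandwich` assumed the path tilt sandwiched
EVERYWHERE (`|f − c| ≤ R`).  On road P4 the window's joint densities are sandwiched only on the GOOD paths (good-class
terms at every level of the window, single-run cores); the complement `B` (bad classes, core complements, threshold
shells of the window's levels) carries small mass under BOTH runs' laws — `P(B) ≤ w`, `Q(B) ≤ w'` — exactly as on the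
law side of the road (NODES W ∕ D with shifted index).  This file proves the corresponding DEFECT version: the dressing
means still differ in `L¹(Q_Y)` by at most `2ρ′·(e^{2R}∕(1 − w′) + 2w) + 4(w + w′)` with
`ρ′ = e^{2R}∕(1 − w) − e^{−2R}(1 − w′)` (≈ `8R + 6w + 6w′` to first order) — LINEAR in the mean defects, no `W < 1`-type
denominator beyond `w, w′ < 1`, no range of `f` on `B` (only a global bound for integrability, which enters no constant).
So NODE Q's two-run part is, with its bad classes, the window-level instances of the road's leaves S ∕ W ∕ D + kernel.

WHAT IS PROVED.
* `integral_exp_bounds_of_sandwich_off` : `e^{c−R}(1 − w) ≤ Z ≤ e^{c+R}∕(1 − w′)` for `Z = ∫e^{f}dP`.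
* `integral_abs_dressing_sub_le_of_sandwich_off` : the defect version of the stability bound.
-/

noncomputable section

open MeasureTheory

namespace Summit.QuantumFields.BalabanUV.T4Continuum.NE7LawLevel

open Literature.MathematicalPhysics.QuantumFieldTheory.Balaban1983to89
open T4VarianceMatching

variable {Ω X : Type*} [MeasurableSpace Ω] [MeasurableSpace X]

/-- **Partition-function bounds from a sandwich OFF a bad set.**  `P` a probability measure, `|f| ≤ Bf`, `|f − c| ≤ R`
off the measurable set `B`, `P(B) ≤ w`, `(P.tilted f)(B) ≤ w′ < 1`.  Then `Z := ∫ e^{f} dP` satisfies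
`e^{c−R}(1 − w) ≤ Z` and `Z(1 − w′) ≤ e^{c+R}`. [folklore] -/
theorem integral_exp_bounds_of_sandwich_off (P : Measure Ω) [IsProbabilityMeasure P] {f : Ω → ℝ}
    (hf : Measurable f) {Bf : ℝ} (hfB : ∀ ω, |f ω| ≤ Bf) {B : Set Ω} (hB : MeasurableSet B) {c R w w' : ℝ}
    (hR : ∀ ω, ω ∉ B → |f ω - c| ≤ R) (hw : P.real B ≤ w) (hw' : (P.tilted f).real B ≤ w') :
    Real.exp (c - R) * (1 - w) ≤ ∫ x, Real.exp (f x) ∂P ∧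
      (∫ x, Real.exp (f x) ∂P) * (1 - w') ≤ Real.exp (c + R) := by
  have hfi : Integrable (fun x => Real.exp (f x)) P :=
    integrable_of_abs_le P hf.exp (B := Real.exp Bf) fun x => by
      rw [abs_of_pos (Real.exp_pos _)]; exact Real.exp_le_exp.mpr (abs_le.mp (hfB x)).2
  have hZpos : 0 < ∫ x, Real.exp (f x) ∂P := integral_exp_pos hfi
  set Z := ∫ x, Real.exp (f x) ∂P with hZ
  -- split Z over B and Bᶜ
  have hsplit : ∫ x in B, Real.exp (f x) ∂P + ∫ x in Bᶜ, Real.exp (f x) ∂P = Z :=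
    integral_add_compl hB hfi
  -- the B-part is Z · Q(B)
  have hQB : (P.tilted f).real B = (∫ x in B, Real.exp (f x) ∂P) / Z := by
    rw [measureReal_def, tilted_apply_eq_ofReal_integral' f hB, integral_div,
      ENNReal.toReal_ofReal (div_nonneg (setIntegral_nonneg hB fun x _ => (Real.exp_pos _).le) hZpos.le)]
  have hBpart : ∫ x in B, Real.exp (f x) ∂P = Z * (P.tilted f).real B := by
    rw [hQB, mul_div_cancel₀ _ hZpos.ne']
  have hBpart_le : ∫ x in B, Real.exp (f x) ∂P ≤ Z * w' := by
    rw [hBpart]; exact mul_le_mul_of_nonneg_left hw' hZpos.le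
  have hBpart_nn : 0 ≤ ∫ x in B, Real.exp (f x) ∂P := setIntegral_nonneg hB fun x _ => (Real.exp_pos _).le
  -- the Bᶜ-part is sandwiched by e^{c∓R} P(Bᶜ)
  have hlo : ∀ x ∈ Bᶜ, Real.exp (c - R) ≤ Real.exp (f x) := fun x hx =>
    Real.exp_le_exp.mpr (by linarith [(abs_le.mp (hR x hx)).1])
  have hhi : ∀ x ∈ Bᶜ, Real.exp (f x) ≤ Real.exp (c + R) := fun x hx =>
    Real.exp_le_exp.mpr (by linarith [(abs_le.mp (hR x hx)).2])
  have hCup : ∫ x in Bᶜ, Real.exp (f x) ∂P ≤ Real.exp (c + R) * P.real Bᶜ := by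
    have h := setIntegral_mono_on hfi.integrableOn (integrable_const _).integrableOn hB.compl hhi
    rwa [setIntegral_const, smul_eq_mul, mul_comm] at h
  have hClo : Real.exp (c - R) * P.real Bᶜ ≤ ∫ x in Bᶜ, Real.exp (f x) ∂P := by
    have h := setIntegral_mono_on (integrable_const _).integrableOn hfi.integrableOn hB.compl hlo
    rwa [setIntegral_const, smul_eq_mul, mul_comm] at h
  have hPc : P.real Bᶜ = 1 - P.real B := probReal_compl_eq_one_sub hB
  have hPc1 : P.real Bᶜ ≤ 1 := by rw [hPc]; linarith [measureReal_nonneg (μ := P) (s := B)]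
  constructor
  · calc Real.exp (c - R) * (1 - w) ≤ Real.exp (c - R) * P.real Bᶜ := by
          rw [hPc]; exact mul_le_mul_of_nonneg_left (by linarith) (Real.exp_pos _).le
      _ ≤ ∫ x in Bᶜ, Real.exp (f x) ∂P := hClo
      _ ≤ Z := by linarith [hsplit, hBpart_nn]
  · have : Z - Z * w' ≤ Real.exp (c + R) := by
      calc Z - Z * w' ≤ Z - ∫ x in B, Real.exp (f x) ∂P := by linarith [hBpart_le]
        _ = ∫ x in Bᶜ, Real.exp (f x) ∂P := by linarith [hsplit]
        _ ≤ Real.exp (c + R) * P.real Bᶜ := hCup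
        _ ≤ Real.exp (c + R) * 1 := mul_le_mul_of_nonneg_left hPc1 (Real.exp_pos _).le
        _ = Real.exp (c + R) := mul_one _
    linarith

/-- **Item (k7): stability of conditional dressing means under a tilt sandwiched OFF A BAD SET.**  In the setting of
`NE7LawLevelStability.integral_abs_dressing_sub_le_of_sandwich`, assume the sandwich `|f − c| ≤ R` only off a measurable
set `B` of paths with `P(B) ≤ w < 1` and `(P.tilted f)(B) ≤ w′ < 1` (plus a global bound `|f| ≤ Bf`, used for
integrability only).  Then, with `ρ′ := e^{2R}∕(1 − w) − e^{−2R}(1 − w′)`,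
`∫ |m_Q − m_P| dQ_Y ≤ 2ρ′·(1∕l + 2w) + 4(w + w′)`, `l := e^{−2R}(1 − w′)` (so `1∕l = e^{2R}∕(1 − w′)`). [folklore] -/
theorem integral_abs_dressing_sub_le_of_sandwich_off (P : Measure Ω) [IsProbabilityMeasure P] {f : Ω → ℝ}
    (hf : Measurable f) {Bf : ℝ} (hfB : ∀ ω, |f ω| ≤ Bf) {B : Set Ω} (hB : MeasurableSet B) {c R w w' : ℝ}
    (hR : ∀ ω, ω ∉ B → |f ω - c| ≤ R) (hR0 : 0 ≤ R) (hw : P.real B ≤ w) (hw1 : w < 1)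
    (hw' : (P.tilted f).real B ≤ w') (hw'1 : w' < 1)
    {Y : Ω → X} (hY : Measurable Y) {Φ : Ω → ℝ} (hΦm : Measurable Φ) (hΦb : ∀ ω, |Φ ω| ≤ 1)
    {mP mQ : X → ℝ} (hmPm : Measurable mP) (hmQm : Measurable mQ) (hbP : ∀ x, |mP x| ≤ 1) (hbQ : ∀ x, |mQ x| ≤ 1)
    (hP : ∀ A : Set X, MeasurableSet A → ∫ ω in Y ⁻¹' A, Φ ω ∂P = ∫ x in A, mP x ∂(P.map Y))
    (hQ : ∀ A : Set X, MeasurableSet A →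
      ∫ ω in Y ⁻¹' A, Φ ω ∂(P.tilted f) = ∫ x in A, mQ x ∂((P.tilted f).map Y)) :
    ∫ x, |mQ x - mP x| ∂((P.tilted f).map Y) ≤
      2 * (Real.exp (2 * R) / (1 - w) - Real.exp (-(2 * R)) * (1 - w')) *
          (1 / (Real.exp (-(2 * R)) * (1 - w')) + 2 * w) + 4 * (w + w') := by
  -- abbreviations and basic facts
  set Z := ∫ x, Real.exp (f x) ∂P with hZ
  set d : Ω → ℝ := fun ω => Real.exp (f ω) / Z with hd
  set l : ℝ := Real.exp (-(2 * R)) * (1 - w') with hl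
  set u : ℝ := Real.exp (2 * R) / (1 - w) with hu
  set ρ' : ℝ := u - l with hρ'
  have hfi : Integrable (fun x => Real.exp (f x)) P :=
    integrable_of_abs_le P hf.exp (B := Real.exp Bf) fun x => by
      rw [abs_of_pos (Real.exp_pos _)]; exact Real.exp_le_exp.mpr (abs_le.mp (hfB x)).2
  haveI hQprob : IsProbabilityMeasure (P.tilted f) := isProbabilityMeasure_tilted hfi
  haveI : IsProbabilityMeasure ((P.tilted f).map Y) := Measure.isProbabilityMeasure_map hY.aemeasurable
  have hZpos : 0 < Z := integral_exp_pos hfi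
  have hw0 : 0 ≤ w := le_trans measureReal_nonneg hw
  have hw'0 : 0 ≤ w' := le_trans measureReal_nonneg hw'
  have h1w : 0 < 1 - w := by linarith
  have h1w' : 0 < 1 - w' := by linarith
  obtain ⟨hZlo, hZhi⟩ := integral_exp_bounds_of_sandwich_off P hf hfB hB hR hw hw'
  have hZhi' : Z ≤ Real.exp (c + R) / (1 - w') := by rw [le_div_iff₀ h1w']; exact hZhi
  have hdm : Measurable d := (hf.exp).div_const _
  have hd0 : ∀ ω, 0 < d ω := fun ω => div_pos (Real.exp_pos _) hZpos
  have hl0 : 0 < l := mul_pos (Real.exp_pos _) h1w'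
  have hexp1 : Real.exp (-(2 * R)) ≤ 1 := by
    rw [← Real.exp_zero]; exact Real.exp_le_exp.mpr (by linarith)
  have hl1 : l ≤ 1 := by
    rw [hl]
    calc Real.exp (-(2 * R)) * (1 - w') ≤ 1 * (1 - w') := mul_le_mul_of_nonneg_right hexp1 h1w'.le
      _ ≤ 1 := by linarith
  have hu1 : 1 ≤ u := by
    rw [hu, le_div_iff₀ h1w]
    calc 1 * (1 - w) ≤ 1 := by linarith
      _ ≤ Real.exp (2 * R) := Real.one_le_exp (by linarith)
  have hρ'0 : 0 ≤ ρ' := by rw [hρ']; linarith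
  -- on Bᶜ: l ≤ d ≤ u, hence |d − 1| ≤ ρ'
  have hdB : ∀ ω, ω ∉ B → l ≤ d ω ∧ d ω ≤ u := by
    intro ω hω
    have hlo : Real.exp (c - R) ≤ Real.exp (f ω) := Real.exp_le_exp.mpr (by linarith [(abs_le.mp (hR ω hω)).1])
    have hhi : Real.exp (f ω) ≤ Real.exp (c + R) := Real.exp_le_exp.mpr (by linarith [(abs_le.mp (hR ω hω)).2])
    constructor
    · -- l = e^{-2R}(1-w') ≤ e^{c-R}/Z... : d = e^f/Z ≥ e^{c-R}/Z ≥ e^{c-R}(1-w')/e^{c+R}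
      rw [hd]; simp only
      rw [le_div_iff₀ hZpos]
      calc l * Z = Real.exp (-(2 * R)) * ((1 - w') * Z) := by rw [hl]; ring
        _ ≤ Real.exp (-(2 * R)) * Real.exp (c + R) := by
            refine mul_le_mul_of_nonneg_left ?_ (Real.exp_pos _).le
            rw [mul_comm]; exact hZhi
        _ = Real.exp (c - R) := by rw [← Real.exp_add]; ring_nf
        _ ≤ Real.exp (f ω) := hlo
    · rw [hd]; simp only
      rw [div_le_iff₀ hZpos, hu, div_mul_eq_mul_div, le_div_iff₀ h1w]
      calc Real.exp (f ω) * (1 - w) ≤ Real.exp (c + R) * (1 - w) := mul_le_mul_of_nonneg_right hhi h1w.le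
        _ = Real.exp (2 * R) * (Real.exp (c - R) * (1 - w)) := by
            rw [← mul_assoc, ← Real.exp_add]; ring_nf
        _ ≤ Real.exp (2 * R) * Z := mul_le_mul_of_nonneg_left hZlo (Real.exp_pos _).le
  have hbd : ∀ ω, ω ∉ B → |d ω - 1| ≤ ρ' := fun ω hω => by
    obtain ⟨h1, h2⟩ := hdB ω hω
    rw [hρ', abs_le]; constructor <;> linarith
  -- pointwise majorant of the integrand of D(A): 2ρ' off B, 2(d + 1) on B
  set maj : Ω → ℝ := fun ω => 2 * ρ' + B.indicator (fun ω => 2 * (d ω + 1)) ω with hmaj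
  have hpt : ∀ ω, |(d ω - 1) * (Φ ω - mP (Y ω))| ≤ maj ω := by
    intro ω
    have h2 : |Φ ω - mP (Y ω)| ≤ 2 := (abs_sub _ _).trans (by linarith [hΦb ω, hbP (Y ω)])
    rw [abs_mul, hmaj]; simp only
    by_cases hω : ω ∈ B
    · rw [Set.indicator_of_mem hω]
      have : |d ω - 1| ≤ d ω + 1 := (abs_sub _ _).trans (by rw [abs_of_pos (hd0 ω), abs_one])
      nlinarith [abs_nonneg (d ω - 1), abs_nonneg (Φ ω - mP (Y ω)), hd0 ω]
    · rw [Set.indicator_of_notMem hω, add_zero]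
      nlinarith [hbd ω hω, abs_nonneg (d ω - 1), abs_nonneg (Φ ω - mP (Y ω))]
  have hdi : Integrable d P := by
    have : Integrable (fun ω => Real.exp (f ω) / Z) P := hfi.div_const Z
    exact this
  have hd1i : Integrable (fun ω => 2 * (d ω + 1)) P := (hdi.add (integrable_const (1 : ℝ))).const_mul 2
  have hindi : Integrable (fun ω => B.indicator (fun ω => 2 * (d ω + 1)) ω) P := hd1i.indicator hB
  have hmaji : Integrable maj P := (integrable_const (2 * ρ')).add hindi
  -- ∫ maj over S ≤ 2ρ' P(S) + 2 (Q(B) + P(B))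
  have hQB : (P.tilted f).real B = ∫ x in B, d x ∂P := by
    rw [measureReal_def, tilted_apply_eq_ofReal_integral' f hB,
      ENNReal.toReal_ofReal (setIntegral_nonneg hB fun x _ => (hd0 x).le)]
  have hmajS : ∀ S : Set Ω, MeasurableSet S →
      ∫ ω in S, maj ω ∂P ≤ 2 * ρ' * P.real S + 2 * (w' + w) := by
    intro S hS
    have i1 : Integrable (fun _ : Ω => 2 * ρ') P := integrable_const _
    have i2 : Integrable (fun ω => B.indicator (fun ω => 2 * (d ω + 1)) ω) P := hindi
    have e1 : ∫ ω in S, maj ω ∂P = 2 * ρ' * P.real S + ∫ ω in S, B.indicator (fun ω => 2 * (d ω + 1)) ω ∂P := by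
      show ∫ ω in S, (2 * ρ' + B.indicator (fun ω => 2 * (d ω + 1)) ω) ∂P = _
      rw [integral_add i1.integrableOn i2.integrableOn, setIntegral_const, smul_eq_mul, mul_comm]
    have e2 : ∫ ω in S, B.indicator (fun ω => 2 * (d ω + 1)) ω ∂P ≤ ∫ ω, B.indicator (fun ω => 2 * (d ω + 1)) ω ∂P :=
      setIntegral_le_integral hindi
        (Filter.Eventually.of_forall fun ω => Set.indicator_nonneg (fun x _ => by linarith [hd0 x]) ω)
    have e3 : ∫ ω, B.indicator (fun ω => 2 * (d ω + 1)) ω ∂P = 2 * ((P.tilted f).real B + P.real B) := by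
      rw [integral_indicator hB, integral_const_mul, integral_add hdi.integrableOn (integrable_const (1:ℝ)).integrableOn,
        setIntegral_const, smul_eq_mul, mul_one, hQB]
    calc ∫ ω in S, maj ω ∂P = 2 * ρ' * P.real S + ∫ ω in S, B.indicator (fun ω => 2 * (d ω + 1)) ω ∂P := e1
      _ ≤ 2 * ρ' * P.real S + 2 * ((P.tilted f).real B + P.real B) := by linarith [e2, e3]
      _ ≤ 2 * ρ' * P.real S + 2 * (w' + w) := by linarith [hw, hw']
  -- P(S) ≤ Q(S)/l + w
  have hPS : ∀ S : Set Ω, MeasurableSet S → P.real S ≤ ((P.tilted f).real S) / l + w := by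
    intro S hS
    have hQS : (P.tilted f).real S = ∫ x in S, d x ∂P := by
      rw [measureReal_def, tilted_apply_eq_ofReal_integral' f hS,
        ENNReal.toReal_ofReal (setIntegral_nonneg hS fun x _ => (hd0 x).le)]
    -- d ≥ l·(1 − 1_B) pointwise
    have hptl : ∀ ω, l * (1 - B.indicator (fun _ => (1 : ℝ)) ω) ≤ d ω := by
      intro ω
      by_cases hω : ω ∈ B
      · rw [Set.indicator_of_mem hω]; simp only [sub_self, mul_zero]; exact (hd0 ω).le
      · rw [Set.indicator_of_notMem hω, sub_zero, mul_one]; exact (hdB ω hω).1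
    have hind : Integrable (fun ω => B.indicator (fun _ => (1 : ℝ)) ω) P := (integrable_const _).indicator hB
    have h1 : ∫ ω in S, l * (1 - B.indicator (fun _ => (1 : ℝ)) ω) ∂P ≤ ∫ ω in S, d ω ∂P :=
      setIntegral_mono (((integrable_const _).sub hind).const_mul l).integrableOn hdi.integrableOn hptl
    have h2 : ∫ ω in S, l * (1 - B.indicator (fun _ => (1 : ℝ)) ω) ∂P =
        l * (P.real S - ∫ ω in S, B.indicator (fun _ => (1 : ℝ)) ω ∂P) := by
      rw [integral_const_mul, integral_sub (integrable_const _).integrableOn hind.integrableOn, setIntegral_const,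
        smul_eq_mul, mul_one]
    have h3 : ∫ ω in S, B.indicator (fun _ => (1 : ℝ)) ω ∂P ≤ P.real B := by
      calc ∫ ω in S, B.indicator (fun _ => (1 : ℝ)) ω ∂P ≤ ∫ ω, B.indicator (fun _ => (1 : ℝ)) ω ∂P :=
            setIntegral_le_integral hind (Filter.Eventually.of_forall fun ω =>
              Set.indicator_nonneg (fun _ _ => zero_le_one) ω)
        _ = P.real B := by rw [integral_indicator hB, setIntegral_const, smul_eq_mul, mul_one]
    rw [h2] at h1
    rw [hQS, div_add' _ _ _ hl0.ne', le_div_iff₀ hl0]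
    nlinarith [h1, h3, hw, hl0]
  -- integrability of the integrand of D(A)
  have hgi : Integrable (fun ω => (d ω - 1) * (Φ ω - mP (Y ω))) P := by
    have hb2 : ∀ ω, ‖Φ ω - mP (Y ω)‖ ≤ 2 := fun ω => by
      rw [Real.norm_eq_abs]; exact (abs_sub _ _).trans (by linarith [hΦb ω, hbP (Y ω)])
    have h := (hdi.sub (integrable_const (1 : ℝ))).bdd_mul ((hΦm.sub (hmPm.comp hY)).aestronglyMeasurable)
      (Filter.Eventually.of_forall hb2)
    exact h.congr (Filter.Eventually.of_forall fun ω => mul_comm _ _)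
  -- the per-set bound
  have key : ∀ A : Set X, MeasurableSet A →
      |∫ x in A, (mQ x - mP x) ∂((P.tilted f).map Y)| ≤
        2 * ρ' * (((P.tilted f).map Y).real A / l + w) + 2 * (w' + w) := by
    intro A hA
    have hS : MeasurableSet (Y ⁻¹' A) := hY hA
    rw [setIntegral_dressing_diff_eq P hf hfB hY hΦm hΦb hmPm hmQm hbP hbQ hP hQ hA]
    have hI : |∫ ω in Y ⁻¹' A, (d ω - 1) * (Φ ω - mP (Y ω)) ∂P| ≤ ∫ ω in Y ⁻¹' A, maj ω ∂P :=
      abs_integral_le_integral_abs.trans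
        (setIntegral_mono_on hgi.abs.integrableOn hmaji.integrableOn hS fun ω _ => hpt ω)
    have hQA : (P.tilted f).real (Y ⁻¹' A) = ((P.tilted f).map Y).real A := (map_measureReal_apply hY hA).symm
    calc |∫ ω in Y ⁻¹' A, (d ω - 1) * (Φ ω - mP (Y ω)) ∂P| ≤ ∫ ω in Y ⁻¹' A, maj ω ∂P := hI
      _ ≤ 2 * ρ' * P.real (Y ⁻¹' A) + 2 * (w' + w) := hmajS _ hS
      _ ≤ 2 * ρ' * (((P.tilted f).map Y).real A / l + w) + 2 * (w' + w) := by
          rw [← hQA]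
          exact add_le_add (mul_le_mul_of_nonneg_left (hPS _ hS) (by positivity)) le_rfl
  -- split ∫|g| over A₊ = {mP ≤ mQ} and its complement
  set ν := (P.tilted f).map Y with hν
  set g : X → ℝ := fun x => mQ x - mP x with hg
  have hgm : Measurable g := hmQm.sub hmPm
  have hgνi : Integrable g ν := integrable_of_abs_le ν hgm (B := 2) fun x =>
    (abs_sub _ _).trans (by linarith [hbQ x, hbP x])
  have hAp : MeasurableSet {x | mP x ≤ mQ x} := measurableSet_le hmPm hmQm
  have hsplit := integral_add_compl hAp hgνi.abs
  rw [← hsplit]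
  have e1 : ∫ x in {x | mP x ≤ mQ x}, |g x| ∂ν = ∫ x in {x | mP x ≤ mQ x}, g x ∂ν :=
    setIntegral_congr_fun hAp fun x hx => by
      simp only [Set.mem_setOf_eq] at hx; rw [hg]; exact abs_of_nonneg (by simp only; linarith)
  have e2 : ∫ x in {x | mP x ≤ mQ x}ᶜ, |g x| ∂ν = -∫ x in {x | mP x ≤ mQ x}ᶜ, g x ∂ν := by
    rw [← integral_neg]
    refine setIntegral_congr_fun hAp.compl fun x hx => ?_
    simp only [Set.mem_compl_iff, Set.mem_setOf_eq, not_le] at hx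
    rw [hg]; exact abs_of_neg (by simp only; linarith)
  rw [e1, e2]
  have k1 := key _ hAp
  have k2 := key _ hAp.compl
  have hsum : ν.real {x | mP x ≤ mQ x} + ν.real {x | mP x ≤ mQ x}ᶜ = 1 := by
    rw [measureReal_add_measureReal_compl (μ := ν) hAp, probReal_univ]
  have hc0 : 0 ≤ 2 * ρ' / l := by positivity
  calc ∫ x in {x | mP x ≤ mQ x}, g x ∂ν + -∫ x in {x | mP x ≤ mQ x}ᶜ, g x ∂ν
      ≤ |∫ x in {x | mP x ≤ mQ x}, g x ∂ν| + |∫ x in {x | mP x ≤ mQ x}ᶜ, g x ∂ν| :=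
        add_le_add (le_abs_self _) (neg_le_abs _)
    _ ≤ (2 * ρ' * (ν.real {x | mP x ≤ mQ x} / l + w) + 2 * (w' + w)) +
          (2 * ρ' * (ν.real {x | mP x ≤ mQ x}ᶜ / l + w) + 2 * (w' + w)) := add_le_add k1 k2
    _ = 2 * ρ' * ((ν.real {x | mP x ≤ mQ x} + ν.real {x | mP x ≤ mQ x}ᶜ) / l + 2 * w) + 4 * (w + w') := by
        ring
    _ = 2 * ρ' * (1 / l + 2 * w) + 4 * (w + w') := by rw [hsum]

end Summit.QuantumFields.BalabanUV.T4Continuum.NE7LawLevel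

end
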